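import Literature.MathematicalPhysics.QuantumManyBody.JelliumCutoffKernelBounds
import HarnessLib

/-!
# The Schur (AM–GM) bound for a nonnegative pair kernel: `2∬ w|a||b| ≤ M(‖a‖² + ‖b‖²)`

Topic `Literature/MathematicalPhysics/QuantumManyBody` (the charged Bose gas, `JelliumBoseGas.foldyLaw`).
The elementary operator-norm bound behind the estimates "`≤ 4πℓ⁻³R² n̂₊`" and "`≤ r⁻¹ n̂₊`" of
[LiebSolovej2001, Lemma 5.4] and the Cauchy–Schwarz steps of Lemma 5.6: for a measurable kernel
`w ≥ 0` on `s × s` with `sup_x ∫_s w(x,y)dy ≤ M` and `sup_y ∫_s w(x,y)dx ≤ M`, and measurable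
`a, b ≥ 0`,

`2 ∫_s∫_s w(x,y) a(x) b(y) dy dx ≤ M (∫_s a² + ∫_s b²)`   (`ℝ≥0∞`-valued; `2ab ≤ a² + b²` and Tonelli).

In particular `|⟨f, 𝒜 g⟩| ≤ ½M(‖f‖² + ‖g‖²)` for the integral operator `𝒜` with kernel `w`
(`M = sup_x∫w_{r,R}(x,y)dy ≤ 4πR²`, `JelliumCutoffKernelBounds.backgroundK_cutoffKernel_le`).

* `lintegral_lintegral_kernel_mul_mul_le` — the Schur bound.

## References

* [LiebSolovej2001] E. H. Lieb, J. P. Solovej, Commun. Math. Phys. 217 (2001) 127–163, Lemma 5.4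
  (proof: "norm less than `sup_k V̂_{r,R}(k) ≤ 4πR²`") and Lemma 5.6 (arXiv:cond-mat/0007425, p. 12–13).
-/

noncomputable section

open MeasureTheory Set Filter Real
open scoped ENNReal NNReal Topology

namespace Literature.MathematicalPhysics.QuantumManyBody.JelliumBoseGas

open BoseGas

/-- **The Schur (AM–GM) bound**: for a measurable kernel `w ≥ 0` with `∫_s w(x,y)dy ≤ M` for all
`x` and `∫_s w(x,y)dx ≤ M` for all `y`, and measurable `a, b : ℝ³ → [0,∞]`,
`2∫_s∫_s w(x,y)a(x)b(y) ≤ M(∫_s a² + ∫_s b²)`. [cite: LiebSolovej2001, Lemma 5.4 (proof)] -/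
theorem lintegral_lintegral_kernel_mul_mul_le (s : Set Space)
    {w : Space → Space → ℝ≥0∞} (hw : Measurable (Function.uncurry w)) {M : ℝ≥0∞}
    (h1 : ∀ x, ∫⁻ y in s, w x y ≤ M) (h2 : ∀ y, ∫⁻ x in s, w x y ≤ M)
    {a b : Space → ℝ≥0∞} (ha : Measurable a) (hb : Measurable b) :
    2 * ∫⁻ x in s, ∫⁻ y in s, w x y * (a x * b y) ≤ M * (∫⁻ x in s, a x ^ 2) + M * ∫⁻ y in s, b y ^ 2 := by
  -- pointwise AM–GM (`2pq ≤ p² + q²` in `ℝ≥0∞`; cf. `Current.two_mul_mul_le_sq_add_sq`)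
  have hamgm : ∀ p q : ℝ≥0∞, 2 * (p * q) ≤ p ^ 2 + q ^ 2 := by
    intro p q
    rcases eq_or_ne p ⊤ with rfl | hp
    · simp
    rcases eq_or_ne q ⊤ with rfl | hq
    · simp
    lift p to ℝ≥0 using hp
    lift q to ℝ≥0 using hq
    have h : (2 : ℝ≥0) * (p * q) ≤ p ^ 2 + q ^ 2 := by
      rw [← NNReal.coe_le_coe]
      push_cast
      nlinarith [sq_nonneg ((p : ℝ) - q)]
    exact_mod_cast h
  have hpt : ∀ x y, 2 * (w x y * (a x * b y)) ≤ w x y * a x ^ 2 + w x y * b y ^ 2 := by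
    intro x y
    calc 2 * (w x y * (a x * b y)) = w x y * (2 * (a x * b y)) := by ring
      _ ≤ w x y * (a x ^ 2 + b y ^ 2) := by gcongr; exact hamgm _ _
      _ = w x y * a x ^ 2 + w x y * b y ^ 2 := by ring
  -- measurability
  have hwx : ∀ x, Measurable fun y => w x y := fun x => hw.comp (measurable_const.prodMk measurable_id)
  have hwy : ∀ y, Measurable fun x => w x y := fun y => hw.comp (measurable_id.prodMk measurable_const)
  have hm1 : ∀ x, Measurable fun y => w x y * (a x * b y) := fun x => (hwx x).mul ((hb.const_mul _))
  have hm2 : ∀ x, Measurable fun y => w x y * a x ^ 2 := fun x => (hwx x).mul_const _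
  have hm3 : ∀ x, Measurable fun y => w x y * b y ^ 2 := fun x => (hwx x).mul (hb.pow_const _)
  -- integrate in `y`, then in `x`
  have hinner : ∀ x, 2 * ∫⁻ y in s, w x y * (a x * b y) ≤
      a x ^ 2 * M + ∫⁻ y in s, w x y * b y ^ 2 := by
    intro x
    calc 2 * ∫⁻ y in s, w x y * (a x * b y) = ∫⁻ y in s, 2 * (w x y * (a x * b y)) := by
          rw [lintegral_const_mul _ (hm1 x)]
      _ ≤ ∫⁻ y in s, (w x y * a x ^ 2 + w x y * b y ^ 2) := lintegral_mono fun y => hpt x y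
      _ = (∫⁻ y in s, w x y * a x ^ 2) + ∫⁻ y in s, w x y * b y ^ 2 := lintegral_add_left (hm2 x) _
      _ = a x ^ 2 * (∫⁻ y in s, w x y) + ∫⁻ y in s, w x y * b y ^ 2 := by
          rw [lintegral_mul_const _ (hwx x), mul_comm]
      _ ≤ a x ^ 2 * M + ∫⁻ y in s, w x y * b y ^ 2 := by gcongr; exact h1 x
  have hmI : Measurable fun x => ∫⁻ y in s, w x y * (a x * b y) := by
    have h : Measurable (Function.uncurry fun (x y : Space) => w x y * (a x * b y)) :=
      hw.mul ((ha.comp measurable_fst).mul (hb.comp measurable_snd))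
    exact h.lintegral_prod_right' (ν := volume.restrict s) |>.mono le_rfl le_rfl
  have hmA : Measurable fun x => a x ^ 2 * M := (ha.pow_const _).mul_const _
  have hmB : Measurable fun x => ∫⁻ y in s, w x y * b y ^ 2 := by
    have h : Measurable (Function.uncurry fun (x y : Space) => w x y * b y ^ 2) :=
      hw.mul ((hb.pow_const _).comp measurable_snd)
    exact h.lintegral_prod_right'
  calc 2 * ∫⁻ x in s, ∫⁻ y in s, w x y * (a x * b y)
      = ∫⁻ x in s, 2 * ∫⁻ y in s, w x y * (a x * b y) := by rw [lintegral_const_mul _ hmI]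
    _ ≤ ∫⁻ x in s, (a x ^ 2 * M + ∫⁻ y in s, w x y * b y ^ 2) := lintegral_mono fun x => hinner x
    _ = (∫⁻ x in s, a x ^ 2 * M) + ∫⁻ x in s, ∫⁻ y in s, w x y * b y ^ 2 := lintegral_add_left hmA _
    _ = M * (∫⁻ x in s, a x ^ 2) + ∫⁻ y in s, ∫⁻ x in s, w x y * b y ^ 2 := by
        rw [lintegral_mul_const _ (ha.pow_const _), mul_comm]
        congr 1
        exact lintegral_lintegral_swap ((hw.mul ((hb.pow_const _).comp measurable_snd)).aemeasurable)
    _ = M * (∫⁻ x in s, a x ^ 2) + ∫⁻ y in s, b y ^ 2 * ∫⁻ x in s, w x y := by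
        congr 1
        refine lintegral_congr fun y => ?_
        rw [mul_comm (b y ^ 2), ← lintegral_mul_const _ (hwy y)]
    _ ≤ M * (∫⁻ x in s, a x ^ 2) + ∫⁻ y in s, b y ^ 2 * M := by
        gcongr with y; exact h2 y
    _ = M * (∫⁻ x in s, a x ^ 2) + M * ∫⁻ y in s, b y ^ 2 := by
        rw [lintegral_mul_const _ (hb.pow_const _), mul_comm (∫⁻ y in s, b y ^ 2) M]

end Literature.MathematicalPhysics.QuantumManyBody.JelliumBoseGas
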